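import Literature.NumberTheory.Rogawski1990.ArchBouazizClassMap        -- ★ p851469 (LH10-p01 (g5)): `bzClassMap`, `_of_mem ∕ _of_not_mem`, the moves via ★ `ArchCartanCoordinates`
import Mathlib.Analysis.SpecialFunctions.Trigonometric.DerivHyp
import HarnessLib

/-!
# THE FIBRES OF THE STABLE-CLASS MAP: two chart points with the same class data are related by the symmetry moves, so every periodic flip∕sign-invariant function
# takes the same value on them ((Σ4c) DESCENT of the L3′ SURJ road, part A; Bouaziz 1994 §5.1, Rogawski 1990 §3.6∕§8.2, Shelstad 1979 §4)

Topic `NumberTheory/Rogawski1990`; namespace `Literature.NumberTheory.Rogawski1990`.  THEOREMS ONLY (no `def`, no instance, no axiom, no `sorry`).  Cell `pub/hodgecm-mathlib`,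
crux H413 (`stmt-HodgeConjecture-24833`), line LH3 (closer stub `stub_N9`), letter L3′, SURJ-OF-FORWARD road (RULINGS #22∕#23; binder LH10-p01 (g5)), organ (Σ-REG), brick
**(Σ4c) DESCENT** «descent through the class map at a regular class» (deal 12:47:06Z; interface binder F0P3a-p04 (g25)), part A of three (A fibre ∕ B section ∕ C descent).
Author LH10-p02 (g7).  Count-neutral.

WHAT.  ★ `bzClassMap S c w = (tr γ_w(c), det γ_w(c), e^{i c_{w,1}})` records the stable class of the chart point `(S, c)`.  This file proves the converse of ★ `bzClassMap_add_angleShift`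
∕ `bzClassMap_flipAt` ∕ `bzClassMap_negXAt`: the FIBRES of `c ↦ bzClassMap S c` are exactly the orbits of the moves.  Per place (§1): at a split place `w ∈ S`, equal class data force
`e^{i c′_{w,2}} = e^{i c_{w,2}}` (the sign `e^{iθ′} = −e^{iθ}` allowed by `det = e^{2iθ}` is excluded by the trace, a POSITIVE multiple `eˣ + e⁻ˣ` of `e^{iθ}`), `cosh x′ = cosh x` hence
`x′ = ±x`, and `e^{i c′_{w,1}} = e^{i c_{w,1}}`; at a compact place, equal trace and determinant force equal eigenvalue PAIRS `{e^{ic′₀}, e^{ic′₂}} = {e^{ic₀}, e^{ic₂}}` (the roots of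
`λ² − tλ + d`), i.e. the angles agree modulo `2π` up to the flip.  §2: consequently a function `g` of the chart coordinates which is `2π`-periodic in every angle slot and invariant under
`flipAt w` (`w ∉ S`) and `negXAt w` (`w ∈ S`) satisfies **`bzClassMap S c = bzClassMap S c′ → g c′ = g c`** (`apply_eq_of_bzClassMap_eq`, one place at a time through
`apply_update_eq_of_bzClassMap_apply_eq`).  This is what lets a (P)+(W)-symmetric germ DESCEND to a function of the class (part C).
HONEST LABEL: HC_CM is proved only modulo the 7 printed citations (2 remaining: hLiu418 = stmt-HodgeConjecture-24832, h413 = stmt-HodgeConjecture-24833) until rung 0 closes;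
coordinate bookkeeping, pays nothing by itself.

## References
* [Bouaziz1994IntegralesOrbitales] A. Bouaziz, *Intégrales orbitales sur les groupes de Lie réductifs*, Ann. Sci. ÉNS (4) 27 (1994), §2.3 p. 578; §5.1 p. 588.
* [Rogawski1990] J. D. Rogawski, *Automorphic Representations of Unitary Groups in Three Variables*, Ann. of Math. Stud. 123 (1990), §3.6 p. 31; §8.2 p. 122.
* [Shelstad1979] D. Shelstad, *Characters and inner forms of a quasi-split group over ℝ*, Compositio Math. 39 (1979), §4 pp. 22–23.
-/

set_option autoImplicit false

noncomputable section

open Complex Set Function Real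
open Literature.NumberTheory.Automorphic.ArchCartan

namespace Literature.NumberTheory.Rogawski1990

variable {W : Type*} [DecidableEq W]

/-! ## §1 Per place: equal class data ⇒ the coordinates agree up to the moves -/

section PerPlace

variable (S : Finset W) {c c' : W → Fin 3 → ℝ} {w : W}

/-- Equal class data have equal `U(Φ₁)`-entries: `e^{i c′_{w,1}} = e^{i c_{w,1}}`. [cite: Rogawski1990, §3.6 p. 31] -/
theorem circleExp_one_eq_of_bzClassMap_apply_eq (h : bzClassMap S c w = bzClassMap S c' w) : Circle.exp (c' w 1) = Circle.exp (c w 1) := by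
  by_cases hw : w ∈ S
  · rw [bzClassMap_of_mem hw, bzClassMap_of_mem hw] at h
    exact Circle.ext (congrArg (fun p => p.2.2) h).symm
  · rw [bzClassMap_of_not_mem hw, bzClassMap_of_not_mem hw] at h
    exact Circle.ext (congrArg (fun p => p.2.2) h).symm

/-- **SPLIT PLACE**: equal class data at `w ∈ S` force `e^{i c′_{w,2}} = e^{i c_{w,2}}` and `c′_{w,0} = ± c_{w,0}` (`det` gives `e^{iθ′} = ±e^{iθ}`; the trace `(eˣ + e⁻ˣ) e^{iθ}`, a POSITIVE
multiple of `e^{iθ}`, excludes the sign; then `cosh x′ = cosh x`). [cite: Rogawski1990, §3.6 p. 31] [cite: Shelstad1979, §4 p. 23] -/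
theorem split_eq_of_bzClassMap_apply_eq (hw : w ∈ S) (h : bzClassMap S c w = bzClassMap S c' w) :
    Circle.exp (c' w 2) = Circle.exp (c w 2) ∧ (c' w 0 = c w 0 ∨ c' w 0 = -(c w 0)) := by
  rw [bzClassMap_of_mem hw, bzClassMap_of_mem hw] at h
  have h1 : (((Real.exp (c w 0) + Real.exp (-(c w 0)) : ℝ) : ℂ)) * (Circle.exp (c w 2) : ℂ) =
      (((Real.exp (c' w 0) + Real.exp (-(c' w 0)) : ℝ) : ℂ)) * (Circle.exp (c' w 2) : ℂ) := congrArg (fun p => p.1) h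
  have h2 : (Circle.exp (c w 2) : ℂ) ^ 2 = (Circle.exp (c' w 2) : ℂ) ^ 2 := congrArg (fun p => p.2.1) h
  have hpos : 0 < Real.exp (c w 0) + Real.exp (-(c w 0)) := add_pos (Real.exp_pos _) (Real.exp_pos _)
  have hpos' : 0 < Real.exp (c' w 0) + Real.exp (-(c' w 0)) := add_pos (Real.exp_pos _) (Real.exp_pos _)
  have hu : (Circle.exp (c w 2) : ℂ) ≠ 0 := Circle.coe_ne_zero _
  -- the determinant: `e^{iθ′} = ± e^{iθ}`; the trace excludes the minus sign
  have hθ : (Circle.exp (c' w 2) : ℂ) = Circle.exp (c w 2) := by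
    rcases sq_eq_sq_iff_eq_or_eq_neg.1 h2.symm with h3 | h3
    · exact h3
    · exfalso
      rw [h3, mul_neg, ← neg_mul] at h1
      have h4 := mul_right_cancel₀ hu h1
      rw [← Complex.ofReal_neg, Complex.ofReal_inj] at h4
      linarith
  refine ⟨Circle.ext hθ, ?_⟩
  -- the trace: `cosh x′ = cosh x`
  rw [hθ] at h1
  have h6 := mul_right_cancel₀ hu h1
  have h7 : Real.exp (c w 0) + Real.exp (-(c w 0)) = Real.exp (c' w 0) + Real.exp (-(c' w 0)) := by exact_mod_cast h6
  have h8 : Real.cosh (c' w 0) = Real.cosh (c w 0) := by rw [Real.cosh_eq, Real.cosh_eq, h7]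
  have h9 : |c' w 0| = |c w 0| :=
    le_antisymm (Real.cosh_le_cosh.1 h8.le) (Real.cosh_le_cosh.1 h8.ge)
  exact abs_eq_abs.1 h9

/-- **COMPACT PLACE**: equal class data at `w ∉ S` force equal eigenvalue pairs: `(e^{ic′₀}, e^{ic′₂}) = (e^{ic₀}, e^{ic₂})` or `= (e^{ic₂}, e^{ic₀})` (equal sum and product ⇒
`(a′ − a)(a′ − b) = 0`). [cite: Rogawski1990, §8.2 p. 122] [cite: Shelstad1979, §4 p. 23] -/
theorem compact_eq_of_bzClassMap_apply_eq (hw : w ∉ S) (h : bzClassMap S c w = bzClassMap S c' w) :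
    (Circle.exp (c' w 0) = Circle.exp (c w 0) ∧ Circle.exp (c' w 2) = Circle.exp (c w 2)) ∨
      (Circle.exp (c' w 0) = Circle.exp (c w 2) ∧ Circle.exp (c' w 2) = Circle.exp (c w 0)) := by
  rw [bzClassMap_of_not_mem hw, bzClassMap_of_not_mem hw] at h
  have h1 : (Circle.exp (c w 0) : ℂ) + Circle.exp (c w 2) = Circle.exp (c' w 0) + Circle.exp (c' w 2) := congrArg (fun p => p.1) h
  have h2 : (Circle.exp (c w 0) : ℂ) * Circle.exp (c w 2) = Circle.exp (c' w 0) * Circle.exp (c' w 2) := congrArg (fun p => p.2.1) h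
  have h3 : ((Circle.exp (c' w 0) : ℂ) - Circle.exp (c w 0)) * ((Circle.exp (c' w 0) : ℂ) - Circle.exp (c w 2)) = 0 := by
    have : ((Circle.exp (c' w 0) : ℂ) - Circle.exp (c w 0)) * ((Circle.exp (c' w 0) : ℂ) - Circle.exp (c w 2)) =
        (Circle.exp (c' w 0) : ℂ) ^ 2 - ((Circle.exp (c w 0) : ℂ) + Circle.exp (c w 2)) * Circle.exp (c' w 0) + Circle.exp (c w 0) * Circle.exp (c w 2) := by ring
    rw [this, h1, h2]; ring
  rcases mul_eq_zero.1 h3 with h4 | h4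
  · left
    have ha : (Circle.exp (c' w 0) : ℂ) = Circle.exp (c w 0) := sub_eq_zero.1 h4
    refine ⟨Circle.ext ha, Circle.ext ?_⟩
    have := h1; rw [← ha] at this
    exact (add_left_cancel this).symm
  · right
    have ha : (Circle.exp (c' w 0) : ℂ) = Circle.exp (c w 2) := sub_eq_zero.1 h4
    refine ⟨Circle.ext ha, Circle.ext ?_⟩
    have := h1; rw [← ha, add_comm (Circle.exp (c w 0) : ℂ)] at this
    exact (add_left_cancel this).symm

end PerPlace

/-! ## §2 Invariant functions are constant on the fibres -/

section Invariant

variable (S : Finset W) {g : (W → Fin 3 → ℝ) → ℂ}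
  (hP : ∀ (c : W → Fin 3 → ℝ) (w : W) (i : Fin 3) (k : ℤ), (w ∉ S ∨ i ≠ 0) → g (c + angleShift w i k) = g c)
  (hF : ∀ (c : W → Fin 3 → ℝ) (w : W), w ∉ S → g (flipAt w c) = g c)
  (hN : ∀ (c : W → Fin 3 → ℝ) (w : W), w ∈ S → g (negXAt w c) = g c)

include hP in
/-- `2π`-periodicity read through ★ `Circle.exp`: if `e^{i a} = e^{i (c w i)}` at an angle slot, replacing `c w i` by `a` does not change `g`. [cite: Shelstad1979, §4 p. 22] -/
theorem apply_update_slot_eq_of_circleExp_eq (c : W → Fin 3 → ℝ) (w : W) (i : Fin 3) (hi : w ∉ S ∨ i ≠ 0) {a : ℝ} (ha : Circle.exp a = Circle.exp (c w i)) :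
    g (Function.update c w (Function.update (c w) i a)) = g c := by
  obtain ⟨m, hm⟩ := Circle.exp_eq_exp.1 ha
  have hupd : Function.update c w (Function.update (c w) i a) = c + angleShift w i m := by
    funext w' j
    by_cases hw' : w' = w
    · subst hw'
      rw [Function.update_self, Pi.add_apply, Pi.add_apply]
      by_cases hj : j = i
      · subst hj; rw [Function.update_self, angleShift_apply_self, hm]; ring
      · rw [Function.update_of_ne hj, angleShift_apply_self_of_ne w' hj, add_zero]
    · rw [Function.update_of_ne hw', Pi.add_apply, angleShift_apply_of_ne hw', add_zero]
  rw [hupd, hP c w i m hi]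

include hP hF hN in
/-- **ONE PLACE AT A TIME**: if the class data of `c` and `c′` agree at `w`, replacing the `w`-coordinates of `c` by those of `c′` does not change an invariant `g`.
[cite: Shelstad1979, §4 pp. 22–23] [cite: Rogawski1990, §3.6 p. 31; §8.2 p. 122] -/
theorem apply_update_eq_of_bzClassMap_apply_eq {c c' : W → Fin 3 → ℝ} {w : W} (h : bzClassMap S c w = bzClassMap S c' w) :
    g (Function.update c w (c' w)) = g c := by
  have h1 := circleExp_one_eq_of_bzClassMap_apply_eq S h
  by_cases hw : w ∈ S
  · obtain ⟨h2, h0⟩ := split_eq_of_bzClassMap_apply_eq S hw h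
    -- step 0: the split coordinate, by the sign change if needed
    obtain ⟨d, hd, hdg⟩ : ∃ d : W → Fin 3 → ℝ, d = Function.update c w (Function.update (c w) 0 (c' w 0)) ∧ g d = g c := by
      rcases h0 with h0 | h0
      · refine ⟨_, rfl, ?_⟩
        rw [h0, Function.update_eq_self, Function.update_eq_self]
      · refine ⟨_, rfl, ?_⟩
        have hneg : Function.update c w (Function.update (c w) 0 (c' w 0)) = negXAt w c := by
          funext w' j
          by_cases hw' : w' = w
          · subst hw'
            rw [Function.update_self, negXAt_apply_self]
            by_cases hj : j = 0
            · subst hj; rw [Function.update_self, h0]; rfl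
            · rw [Function.update_of_ne hj]
              fin_cases j
              · exact absurd rfl hj
              · rfl
              · rfl
          · rw [Function.update_of_ne hw', negXAt_apply_of_ne hw']
        rw [hneg, hN c w hw]
    -- steps 1 and 2: the two angles
    have hd1 : d w 1 = c w 1 := by rw [hd, Function.update_self, Function.update_of_ne (by decide : (1 : Fin 3) ≠ 0)]
    have hd2 : d w 2 = c w 2 := by rw [hd, Function.update_self, Function.update_of_ne (by decide : (2 : Fin 3) ≠ 0)]
    have e1 := apply_update_slot_eq_of_circleExp_eq S hP d w 1 (Or.inr one_ne_zero) (a := c' w 1) (by rw [hd1]; exact h1)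
    set d1 := Function.update d w (Function.update (d w) 1 (c' w 1)) with hd1def
    have hd12 : d1 w 2 = c w 2 := by rw [hd1def, Function.update_self, Function.update_of_ne (by decide : (2 : Fin 3) ≠ 1), hd2]
    have e2 := apply_update_slot_eq_of_circleExp_eq S hP d1 w 2 (Or.inr (by decide)) (a := c' w 2) (by rw [hd12]; exact h2)
    have hfin : Function.update d1 w (Function.update (d1 w) 2 (c' w 2)) = Function.update c w (c' w) := by
      funext w' j
      by_cases hw' : w' = w
      · subst hw'
        rw [Function.update_self, Function.update_self]
        fin_cases j
        · show Function.update (d1 w') 2 (c' w' 2) 0 = c' w' 0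
          rw [Function.update_of_ne (by decide : (0 : Fin 3) ≠ 2), hd1def, Function.update_self, Function.update_of_ne (by decide : (0 : Fin 3) ≠ 1), hd,
            Function.update_self, Function.update_self]
        · show Function.update (d1 w') 2 (c' w' 2) 1 = c' w' 1
          rw [Function.update_of_ne (by decide : (1 : Fin 3) ≠ 2), hd1def, Function.update_self, Function.update_self]
        · show Function.update (d1 w') 2 (c' w' 2) 2 = c' w' 2
          rw [Function.update_self]
      · rw [Function.update_of_ne hw', Function.update_of_ne hw', hd1def, Function.update_of_ne hw', hd, Function.update_of_ne hw']
    rw [← hfin, e2, e1, hdg]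
  · rcases compact_eq_of_bzClassMap_apply_eq S hw h with ⟨h0, h2⟩ | ⟨h0, h2⟩
    · -- no flip: three angle shifts
      have e0 := apply_update_slot_eq_of_circleExp_eq S hP c w 0 (Or.inl hw) h0
      set d := Function.update c w (Function.update (c w) 0 (c' w 0)) with hd
      have hd1 : d w 1 = c w 1 := by rw [hd, Function.update_self, Function.update_of_ne (by decide : (1 : Fin 3) ≠ 0)]
      have hd2 : d w 2 = c w 2 := by rw [hd, Function.update_self, Function.update_of_ne (by decide : (2 : Fin 3) ≠ 0)]
      have e1 := apply_update_slot_eq_of_circleExp_eq S hP d w 1 (Or.inl hw) (a := c' w 1) (by rw [hd1]; exact h1)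
      set d1 := Function.update d w (Function.update (d w) 1 (c' w 1)) with hd1def
      have hd12 : d1 w 2 = c w 2 := by rw [hd1def, Function.update_self, Function.update_of_ne (by decide : (2 : Fin 3) ≠ 1), hd2]
      have e2 := apply_update_slot_eq_of_circleExp_eq S hP d1 w 2 (Or.inl hw) (a := c' w 2) (by rw [hd12]; exact h2)
      have hfin : Function.update d1 w (Function.update (d1 w) 2 (c' w 2)) = Function.update c w (c' w) := by
        funext w' j
        by_cases hw' : w' = w
        · subst hw'
          rw [Function.update_self, Function.update_self]
          fin_cases j
          · show Function.update (d1 w') 2 (c' w' 2) 0 = c' w' 0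
            rw [Function.update_of_ne (by decide : (0 : Fin 3) ≠ 2), hd1def, Function.update_self, Function.update_of_ne (by decide : (0 : Fin 3) ≠ 1), hd,
              Function.update_self, Function.update_self]
          · show Function.update (d1 w') 2 (c' w' 2) 1 = c' w' 1
            rw [Function.update_of_ne (by decide : (1 : Fin 3) ≠ 2), hd1def, Function.update_self, Function.update_self]
          · show Function.update (d1 w') 2 (c' w' 2) 2 = c' w' 2
            rw [Function.update_self]
        · rw [Function.update_of_ne hw', Function.update_of_ne hw', hd1def, Function.update_of_ne hw', hd, Function.update_of_ne hw']
      rw [← hfin, e2, e1, e0]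
    · -- flip first, then three angle shifts
      have ef := hF c w hw
      set f := flipAt w c with hf
      have hf0 : f w 0 = c w 2 := by rw [hf, flipAt_apply_self]; rfl
      have hf1 : f w 1 = c w 1 := by rw [hf, flipAt_apply_self]; rfl
      have hf2 : f w 2 = c w 0 := by rw [hf, flipAt_apply_self]; rfl
      have e0 := apply_update_slot_eq_of_circleExp_eq S hP f w 0 (Or.inl hw) (a := c' w 0) (by rw [hf0]; exact h0)
      set d := Function.update f w (Function.update (f w) 0 (c' w 0)) with hd
      have hd1 : d w 1 = c w 1 := by rw [hd, Function.update_self, Function.update_of_ne (by decide : (1 : Fin 3) ≠ 0), hf1]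
      have hd2 : d w 2 = c w 0 := by rw [hd, Function.update_self, Function.update_of_ne (by decide : (2 : Fin 3) ≠ 0), hf2]
      have e1 := apply_update_slot_eq_of_circleExp_eq S hP d w 1 (Or.inl hw) (a := c' w 1) (by rw [hd1]; exact h1)
      set d1 := Function.update d w (Function.update (d w) 1 (c' w 1)) with hd1def
      have hd12 : d1 w 2 = c w 0 := by rw [hd1def, Function.update_self, Function.update_of_ne (by decide : (2 : Fin 3) ≠ 1), hd2]
      have e2 := apply_update_slot_eq_of_circleExp_eq S hP d1 w 2 (Or.inl hw) (a := c' w 2) (by rw [hd12]; exact h2)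
      have hfin : Function.update d1 w (Function.update (d1 w) 2 (c' w 2)) = Function.update c w (c' w) := by
        funext w' j
        by_cases hw' : w' = w
        · subst hw'
          rw [Function.update_self, Function.update_self]
          fin_cases j
          · show Function.update (d1 w') 2 (c' w' 2) 0 = c' w' 0
            rw [Function.update_of_ne (by decide : (0 : Fin 3) ≠ 2), hd1def, Function.update_self, Function.update_of_ne (by decide : (0 : Fin 3) ≠ 1), hd,
              Function.update_self, Function.update_self]
          · show Function.update (d1 w') 2 (c' w' 2) 1 = c' w' 1
            rw [Function.update_of_ne (by decide : (1 : Fin 3) ≠ 2), hd1def, Function.update_self, Function.update_self]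
          · show Function.update (d1 w') 2 (c' w' 2) 2 = c' w' 2
            rw [Function.update_self]
        · rw [Function.update_of_ne hw', Function.update_of_ne hw', hd1def, Function.update_of_ne hw', hd, Function.update_of_ne hw', hf, flipAt_apply_of_ne hw']
      rw [← hfin, e2, e1, e0, ef]

include hP hF hN in
/-- **INVARIANT FUNCTIONS ARE CONSTANT ON THE FIBRES OF THE CLASS MAP**: if `g` is `2π`-periodic in every angle slot of the chart `S` and invariant under the compact flips and the
split sign changes, then `bzClassMap S c = bzClassMap S c′ → g c′ = g c` (one place at a time over `Finset.univ`). [cite: Bouaziz1994IntegralesOrbitales, §5.1 p. 588]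
[cite: Shelstad1979, §4 pp. 22–23] [cite: Rogawski1990, §3.6 p. 31; §8.2 p. 122] -/
theorem apply_eq_of_bzClassMap_eq [Fintype W] {c c' : W → Fin 3 → ℝ} (h : bzClassMap S c = bzClassMap S c') : g c' = g c := by
  -- replace the places of `c` by those of `c'` along a finset `T`
  have key : ∀ T : Finset W, g (fun w => if w ∈ T then c' w else c w) = g c := by
    intro T
    induction T using Finset.induction_on with
    | empty => simp only [Finset.notMem_empty, if_false]
    | insert w T hwT ih =>
      have hupd : (fun w' => if w' ∈ insert w T then c' w' else c w') = Function.update (fun w' => if w' ∈ T then c' w' else c w') w (c' w) := by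
        funext w'
        by_cases hw' : w' = w
        · subst hw'; simp only [Finset.mem_insert, true_or, if_true, Function.update_self]
        · rw [Function.update_of_ne hw']
          simp only [Finset.mem_insert, hw', false_or]
      rw [hupd, apply_update_eq_of_bzClassMap_apply_eq S hP hF hN (c := fun w' => if w' ∈ T then c' w' else c w') (c' := c') ?_, ih]
      rw [← congrFun h w]
      exact bzClassMap_congr S (by simp only [hwT, if_false])
  have hfin := key Finset.univ
  simp only [Finset.mem_univ, if_true] at hfin
  exact hfin

end Invariant

end Literature.NumberTheory.Rogawski1990

end
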